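import Summits.RiemannHypothesis.RiemannHypothesis.Theses.SignCone
import Summits.RiemannHypothesis.RiemannHypothesis.Theorems.ConeMagnification.Negative.LoadBearing

/-!
# `SignCone.ConeMagnification` (crux stmt-RiemannHypothesis-16303): the unit-slack cone contains a
# whole `ℓ¹(n^{-1/2})`-ball around `Λ` (under RH) — negative-side support, cdisprove cycle 1

Companion of `Negative/LoadBearing.lean` §D (single-prime deletions). The magnification step of the
route (2001 W-MAG) must prove RH from ONE nonnegative weight `c` whose fake Weil form `W_ar - P_c` has
unit slack against every Weil test. This file records how UN-rigid that uniform cone is when RH holds: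

* `coneMagnification_slackCone_of_variation_le_half` — for ANY finitely supported perturbation `m`
  (any signs, primes, prime powers or composites alike) with `Σₙ |m(n)|/√n ≤ 1/2`, the weight `Λ + m`
  has unit slack against every Weil test (`|G(± log n)| ≤ ‖g‖₂²`, Bombieri 2000 §4 Lemma 2). So, under
  RH, the uniform unit-slack cone contains `{Λ + m : m finitely supported, Λ + m ≥ 0, ‖m‖_{ℓ¹(n^{-1/2})} ≤ 1/2}`:
  weights supported OFF the prime powers (fake "primes" at composites), weights exceeding `Λ`, weights
  vanishing at small primes. Consequently no stub of the form "a cone weight is supported on prime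
  powers", "`c ≤ Λ`", "`c(p) ≥ log p - o(1)` for small `p`" (the 2001 programme's one-sided Hypothesis P,
  if read for the SLACK cone) can hold; what survives is the `ℓ¹(n^{-1/2})`-scale: the crux disprover's
  dual-certificate heuristic (`Cruxes/ConeMagnification/Disproof.lean` §C) predicts conversely
  `Σ_p |c(p) - log p|/√p ≤ 1` for every cone weight.
* `coneMagnification_exists_slackCone_composite_support_of_riemannHypothesis` — a concrete instance:
  `Λ + (1/2)·√6·𝟙{n = 6}` (a fake prime power at the composite `6`, of full budget) is a nonnegative
  weight, vanishing at `1`, with unit slack against every Weil test.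
-/

noncomputable section

-- `Summit.RiemannHypothesis.RiemannHypothesis.…` repeats a namespace component by design (D-0017 layout).
set_option linter.dupNamespace false

open scoped BigOperators ArithmeticFunction.vonMangoldt ComplexConjugate
open MeasureTheory Set Literature.NumberTheory.LFunctions
open Summit.RiemannHypothesis.RiemannHypothesis.Theses.SignCone

namespace Summit.RiemannHypothesis.RiemannHypothesis.Theorems.ConeMagnification.Negative

/-- **The `ℓ¹(n^{-1/2})`-ball of radius `1/2` around `Λ` is in the uniform unit-slack cone (under RH).**
If `m : ℕ → ℝ` vanishes off a finite set `S` and `Σ_{n ∈ S} |m(n)|/√n ≤ 1/2`, then the weight `Λ + m`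
satisfies the unit-slack inequality of the crux against EVERY Weil test `g`: the fake form is
`Q(g) - Σ_{n∈S} m(n) n^{-1/2} (G(log n) + G(-log n))`, `G = g ⋆ g̃`, with `Re Q(g) ≥ 0` under RH
(`WeilPositivity.of_riemannHypothesis explicit_formula_holds`) and `|G| ≤ ‖g‖₂²`
(`norm_weilConv_weilReflect_le`). No sign condition on `m` and no restriction to prime powers. [folklore] -/
theorem coneMagnification_slackCone_of_variation_le_half (hRH : Summit.RiemannHypothesis)
    {m : ℕ → ℝ} (S : Finset ℕ) (hmS : ∀ n ∉ S, m n = 0)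
    (hvar : ∑ n ∈ S, |m n| / Real.sqrt n ≤ 1 / 2) :
    ∀ g : ℝ → ℂ, (ContDiff ℝ ((⊤ : ℕ∞) : WithTop ℕ∞) g ∧ HasCompactSupport g) → let G : ℝ → ℂ := MeasureTheory.convolution g (fun u => (starRingEnd ℂ) (g (-u))) (ContinuousLinearMap.mul ℂ ℂ) MeasureTheory.MeasureSpace.volume; let M : ℂ → ℂ := fun s => ∫ u : ℝ, G u * Complex.exp ((s - 1 / 2) * u); -(∫ t, ‖g t‖ ^ 2) ≤ (M 0 + M 1 + ((1 / (2 * Real.pi) : ℂ) * (∫ t : ℝ, M (1 / 2 + t * Complex.I) * ((Complex.digamma (1 / 4 + t / 2 * Complex.I)).re : ℂ)) - G 0 * (Real.log Real.pi : ℂ)) - ∑' n : ℕ, ((((Λ n : ℝ) + m n : ℝ) : ℝ) : ℂ) / (Real.sqrt n : ℂ) * (G (Real.log n) + G (-Real.log n))).re := by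
  intro g hg
  have hg' : IsWeilTest g := hg
  set N : ℝ := ∫ t : ℝ, ‖g t‖ ^ 2 with hNdef
  have hN : 0 ≤ N := integral_nonneg fun _ => by positivity
  set G : ℝ → ℂ := weilConv g (weilReflect g) with hG
  have hGc : HasCompactSupport G := (hg'.weilConv hg'.weilReflect).2
  show -N ≤ (weilPolarTerm G + weilArchTerm G -
      ∑' n : ℕ, ((((Λ n : ℝ) + m n : ℝ) : ℝ) : ℂ) / (Real.sqrt n : ℂ) * (G (Real.log n) + G (-Real.log n))).re
  -- the perturbation terms and the splitting of the fake prime sum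
  set D : ℕ → ℂ := fun n => ((m n : ℝ) : ℂ) / (Real.sqrt n : ℂ) * (G (Real.log n) + G (-Real.log n)) with hD
  have hΛ : Summable fun n : ℕ => ((Λ n : ℝ) : ℂ) / (Real.sqrt n : ℂ) * (G (Real.log n) + G (-Real.log n)) :=
    summable_weilPrimeTerm hGc
  have hD0 : ∀ n ∉ S, D n = 0 := fun n hn => by simp [hD, hmS n hn]
  have hDsum : Summable D := summable_of_ne_finset_zero hD0
  have hDeq : ∑' n, D n = ∑ n ∈ S, D n := tsum_eq_sum hD0
  have hsplit : (∑' n : ℕ, ((((Λ n : ℝ) + m n : ℝ) : ℝ) : ℂ) / (Real.sqrt n : ℂ) *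
        (G (Real.log n) + G (-Real.log n))) = weilPrimeTerm G + ∑ n ∈ S, D n := by
    have h1 : ∀ n : ℕ, ((((Λ n : ℝ) + m n : ℝ) : ℝ) : ℂ) / (Real.sqrt n : ℂ) *
        (G (Real.log n) + G (-Real.log n)) =
          ((Λ n : ℝ) : ℂ) / (Real.sqrt n : ℂ) * (G (Real.log n) + G (-Real.log n)) + D n := by
      intro n
      simp only [hD]
      push_cast
      ring
    simp_rw [h1]
    rw [hΛ.tsum_add hDsum, hDeq]
    rfl
  -- Weil positivity under RH and the pointwise bound `|G| ≤ ‖g‖₂²`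
  have hW : 0 ≤ (weilQuadratic g).re :=
    WeilPositivity.of_riemannHypothesis explicit_formula_holds hRH g hg'
  have hQ : weilPolarTerm G + weilArchTerm G - (weilPrimeTerm G + ∑ n ∈ S, D n) =
      weilQuadratic g - ∑ n ∈ S, D n := by
    simp only [weilQuadratic, weilFunctional, hG]
    ring
  have hGle : ∀ t, ‖G t‖ ≤ N := fun t => norm_weilConv_weilReflect_le hg' t
  have hDn : ∀ n, ‖D n‖ ≤ |m n| / Real.sqrt n * (2 * N) := by
    intro n
    have hcoef : ‖((m n : ℝ) : ℂ) / (Real.sqrt n : ℂ)‖ = |m n| / Real.sqrt n := by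
      rw [norm_div, Complex.norm_real, Complex.norm_real, Real.norm_eq_abs,
        Real.norm_of_nonneg (Real.sqrt_nonneg _)]
    calc ‖D n‖ = |m n| / Real.sqrt n * ‖G (Real.log n) + G (-Real.log n)‖ := by
          rw [hD, norm_mul, hcoef]
      _ ≤ |m n| / Real.sqrt n * (N + N) :=
          mul_le_mul_of_nonneg_left ((norm_add_le _ _).trans (add_le_add (hGle _) (hGle _)))
            (div_nonneg (abs_nonneg _) (Real.sqrt_nonneg _))
      _ = |m n| / Real.sqrt n * (2 * N) := by ring
  have hEn : ‖∑ n ∈ S, D n‖ ≤ N := by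
    calc ‖∑ n ∈ S, D n‖ ≤ ∑ n ∈ S, ‖D n‖ := norm_sum_le _ _
      _ ≤ ∑ n ∈ S, |m n| / Real.sqrt n * (2 * N) := Finset.sum_le_sum fun n _ => hDn n
      _ = (∑ n ∈ S, |m n| / Real.sqrt n) * (2 * N) := by rw [Finset.sum_mul]
      _ ≤ (1 / 2) * (2 * N) := mul_le_mul_of_nonneg_right hvar (by positivity)
      _ = N := by ring
  have hEre : (∑ n ∈ S, D n).re ≤ N :=
    ((abs_le.1 (Complex.abs_re_le_norm _)).2).trans hEn
  rw [hsplit, hQ, Complex.sub_re]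
  linarith

/-- **A cone weight supported off the prime powers (under RH).** The weight `Λ + (√6/2)·𝟙{n = 6}` —
`Λ` plus a fake prime power of full budget at the composite `6` — is nonnegative, vanishes at `1`, and
has unit slack against every Weil test. So "a weight in the uniform unit-slack cone is supported on
prime powers" and "`c ≤ Λ`" are false under RH (compare `coneMagnification_not_slackConeRigid_of_riemannHypothesis`:
"`c ≥ Λ` on primes" is false too). [folklore] -/
theorem coneMagnification_exists_slackCone_composite_support_of_riemannHypothesis
    (hRH : Summit.RiemannHypothesis) :
    ∃ c : ℕ → ℝ, (∀ n, 0 ≤ c n) ∧ c 1 = 0 ∧ c 6 = Real.sqrt 6 / 2 ∧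
      (∀ g : ℝ → ℂ, (ContDiff ℝ ((⊤ : ℕ∞) : WithTop ℕ∞) g ∧ HasCompactSupport g) → let G : ℝ → ℂ := MeasureTheory.convolution g (fun u => (starRingEnd ℂ) (g (-u))) (ContinuousLinearMap.mul ℂ ℂ) MeasureTheory.MeasureSpace.volume; let M : ℂ → ℂ := fun s => ∫ u : ℝ, G u * Complex.exp ((s - 1 / 2) * u); -(∫ t, ‖g t‖ ^ 2) ≤ (M 0 + M 1 + ((1 / (2 * Real.pi) : ℂ) * (∫ t : ℝ, M (1 / 2 + t * Complex.I) * ((Complex.digamma (1 / 4 + t / 2 * Complex.I)).re : ℂ)) - G 0 * (Real.log Real.pi : ℂ)) - ∑' n : ℕ, ((c n : ℝ) : ℂ) / (Real.sqrt n : ℂ) * (G (Real.log n) + G (-Real.log n))).re) := by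
  have h6 : ¬ IsPrimePow (6 : ℕ) := by
    rw [isPrimePow_nat_iff_bounded]
    decide
  have hΛ6 : Λ 6 = 0 := ArithmeticFunction.vonMangoldt_eq_zero_iff.2 h6
  have hsq : 0 ≤ Real.sqrt 6 / 2 := by positivity
  refine ⟨fun n => (Λ n : ℝ) + if n = 6 then Real.sqrt 6 / 2 else 0, fun n => ?_,
    by simp [ArithmeticFunction.vonMangoldt_apply_one], by simp [hΛ6], ?_⟩
  · by_cases hn : n = 6
    · subst hn
      simp [hΛ6, hsq]
    · simp [hn, ArithmeticFunction.vonMangoldt_nonneg]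
  · refine coneMagnification_slackCone_of_variation_le_half
      (m := fun n => if n = 6 then Real.sqrt 6 / 2 else 0) hRH {6} (fun n hn => ?_) ?_
    · rw [Finset.mem_singleton] at hn
      simp [hn]
    · have hs6 : 0 < Real.sqrt 6 := Real.sqrt_pos.2 (by norm_num)
      rw [Finset.sum_singleton, Nat.cast_ofNat, if_pos rfl, abs_of_nonneg hsq]
      rw [div_div, div_le_iff₀ (by positivity)]
      nlinarith [Real.mul_self_sqrt (show (0 : ℝ) ≤ 6 by norm_num)]

end Summit.RiemannHypothesis.RiemannHypothesis.Theorems.ConeMagnification.Negative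

end
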